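import Summits.Ventures.LatticeQCDFlow.Exactness.IMHTauIntParityDefect
import Summits.Ventures.LatticeQCDFlow.Exactness.FlowSamplerAutocorrelation
import HarnessLib

/-!
# The `τ_int` column under a NON-uniform parity, window-free: a weight ceiling on the other model
# turns the window defect into `4e^{−δ}(B·C'/Z)²·min(w(E), Z·q(E))`

HONEST FRAMING: exact (Metropolis-corrected) sampling algorithms for lattice gauge theory;
figures of merit are autocorrelation/cost numbers at stated couplings and volumes; no
continuum-physics claim.

Venture `LatticeQCDFlow` (cell pub-lqcd), topic `Exactness`; FANOUT row 4 (`s0-u1-b`, rung S0-B: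
two independent codes for the 2D U(1) flow sampler, compared by acceptance and `τ_int(Q)`).
Sequel of `IMHTauIntParityDefect.lean` (same seat, same day), whose window law
`Σ_{k≤N} C'(k) ≤ e^{δ}S + e^{−δ}·4((N+1)B)²·min(∫_E w, Z∫_E q)` pays the window through the crude
sup bound `|v'_N| ≤ (N+1)B` on the partial Neumann sums `v'_N = Σ_{k≤N} K'ᵏ g`.  Under a WEIGHT
CEILING for the other model, `w ≤ C'·q'` (the cell's `W' = C'/Z = sup w/(Z q')`, the hypothesis of
`FlowSamplerSpectralGap` / `FlowSamplerAutocorrelation`), the minorisation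
`α'(t,t') q'(t') ≥ w(t')/C'` (`FlowSamplerOperator.imhAcceptQ_mul_ge`) makes `K'` a SUP-NORM
contraction by `1 − Z/C'` on centred observables, so `|v'_N| ≤ B·C'/Z` for every `N` and the
defect no longer grows with the window.  NEW WORK of the cell; nothing is cited as a fact (Doeblin's
minorisation argument, folklore); no definition is introduced.

## What is proved (`(X, μ)` s-finite; `w > 0` measurable integrable, `Z = ∫ w`; `q, q' > 0`
measurable, `∫ q = ∫ q' = 1`; `K = imhOp μ w q`, `K' = imhOp μ w q'`)

* §1 **`abs_imhOp_le_rate_mul_of_centred`** — `w ≤ C q`, `∫ g w = 0`, `|g| ≤ B` ⇒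
  `|K g(t)| ≤ (1 − Z/C)·B` for every `t` (SUP-NORM Doeblin contraction; the tree had the `L²`
  form, `FlowSamplerSpectralGap.integral_imhOp_sq_le`); **`abs_imhOp_iterate_le_of_centred`** —
  `|Kⁿ g(t)| ≤ (1 − Z/C)ⁿ·B`; **`abs_neumannSum_le_of_centred`** — `|Σ_{k≤N} Kᵏ g(t)| ≤ B·C/Z`.
* §2 **`partialSum_autocov_le_of_logParityOff_of_neumannBound`** — the window law of the predecessor
  with an ARBITRARY uniform bound `V` on the Neumann sums of `K'` in place of `(N+1)B`:
  parity `|log q − log q'| ≤ δ` off `E`, `g` bounded measurable with summable autocovariances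
  under `K` ⇒ `Σ_{k≤N} ∫ g (K'ᵏ g) w ≤ e^{δ}·S + e^{−δ}·4V²·min(∫_E w, Z∫_E q)` for every `N`
  (`S = ∫ g² w + Σ_{k≥0} ∫ g (K^{k+1} g) w`).
* §3 **`greenKubo_le_of_logParityOff_of_weightBound`** — with `w ≤ C'·q'` and `∫ g w = 0`: the
  autocovariances under `K'` are summable and
  `∫ g² w + Σ_{k≥0} ∫ g (K'^{k+1} g) w ≤ e^{δ}·S + e^{−δ}·4(B C'/Z)²·min(∫_E w, Z∫_E q)`;
  **`imhOp_tauInt_le_of_logParityOff_of_weightBound`** — on `Scoring.tauInt` (`∫ g² w > 0`):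
  `τ' + ½ ≤ e^{δ}(τ + ½) + e^{−δ}·4(B C'/Z)²·min(∫_E w, Z∫_E q)/∫ g² w` — WINDOW-FREE.

Reading for row 4 (value-free; no number of ours, no sealed value): the full `τ_int` column of an
A-vs-B table IS certified by a density parity that fails on a set `E`, provided the other code's
importance weights are bounded: the exceptional set then enters as (its target-or-model-A mass)
× (the other code's weight ceiling `W' = C'/Z`)² × `B²/E_π g²` — mass times the SQUARE of the
weight level, where the ESS column had mass times the weight level (`Scaling/DensityParityTargetSide`)
and the acceptance column the mass alone.  On the two-point witness of `DensityParityCertificates`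
§2 (`W' = 1/η`, mass `ε`, `B²/E_π g² ≈ 1/ε`) the bound reads `≈ 4/η²` against the truth `1/η`:
the square is the price of the sup-norm route, not claimed sharp.  NOT CLAIMED: sharpness; the
reverse inequality (symmetric); anything without a weight ceiling beyond the window law; HMC /
local Metropolis; unbounded observables; any number re-scored.
-/

namespace Summit.Ventures.LatticeQCDFlow.Exactness

open Real MeasureTheory Filter Set Topology
open Summit.Ventures.LatticeQCDFlow.Scoring

variable {X : Type*} [MeasurableSpace X] {μ : Measure X} {w q : X → ℝ}

/-! ## §1 Sup-norm Doeblin contraction on centred observables -/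

/-- **SUP-NORM CONTRACTION ON CENTRED OBSERVABLES.**  `w ≤ C·q` pointwise, `∫ q = 1`; `g`
bounded measurable, `|g| ≤ B`, centred `∫ g w = 0`.  Then `|K g(t)| ≤ (1 − Z/C)·B` for every `t`
(`K g(t) = ∫ [(α q − w/C) g(t') + (1 − α) q g(t)] dt'` with both brackets nonnegative by the
minorisation `α(t,t') q(t') ≥ w(t')/C`). [folklore] -/
theorem abs_imhOp_le_rate_mul_of_centred (hw0 : ∀ t, 0 < w t) (hwm : Measurable w)
    (hwi : Integrable w μ) (hq0 : ∀ t, 0 < q t) (hqm : Measurable q) (hqi : Integrable q μ)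
    (hq1 : ∫ t, q t ∂μ = 1) {C : ℝ} (hC : ∀ t, w t ≤ C * q t) {g : X → ℝ} (hgm : Measurable g)
    {B : ℝ} (hgb : ∀ t, |g t| ≤ B) (hg0 : ∫ t, g t * w t ∂μ = 0) (t : X) :
    |imhOp μ w q g t| ≤ (1 - (∫ s, w s ∂μ) / C) * B := by
  have hCpos : 0 < C := pos_of_mul_pos_left ((hw0 t).trans_le (hC t)) (hq0 t).le
  have hB : 0 ≤ B := (abs_nonneg _).trans (hgb t)
  have hF := integrable_imhOp_integrand hw0 hwm hq0 hqm hqi hgm hgb t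
  have hwC : Integrable (fun t' => w t' / C) μ := hwi.div_const C
  have hgw : Integrable (fun t' => g t' * (w t' / C)) μ := by
    refine Integrable.mono' (hwC.const_mul B) (hgm.mul (hwm.div_const C)).aestronglyMeasurable
      (Eventually.of_forall fun t' => ?_)
    rw [Real.norm_eq_abs, abs_mul, abs_of_nonneg (div_nonneg (hw0 t').le hCpos.le)]
    exact mul_le_mul_of_nonneg_right (hgb t') (div_nonneg (hw0 t').le hCpos.le)
  have hI0 : ∫ t', g t' * (w t' / C) ∂μ = 0 := by
    have e : (fun t' => g t' * (w t' / C)) = fun t' => (1 / C) * (g t' * w t') := by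
      funext t'; ring
    rw [e, integral_const_mul, hg0, mul_zero]
  unfold imhOp
  have key : ∫ t', (imhAcceptQ w q t t' * g t' + (1 - imhAcceptQ w q t t') * g t) * q t' ∂μ
      = ∫ t', ((imhAcceptQ w q t t' * g t' + (1 - imhAcceptQ w q t t') * g t) * q t'
          - g t' * (w t' / C)) ∂μ := by
    rw [integral_sub hF hgw, hI0, sub_zero]
  rw [key]
  calc |∫ t', ((imhAcceptQ w q t t' * g t' + (1 - imhAcceptQ w q t t') * g t) * q t'
          - g t' * (w t' / C)) ∂μ|
      ≤ ∫ t', |(imhAcceptQ w q t t' * g t' + (1 - imhAcceptQ w q t t') * g t) * q t'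
          - g t' * (w t' / C)| ∂μ := abs_integral_le_integral_abs
    _ ≤ ∫ t', B * (q t' - w t' / C) ∂μ := by
        refine integral_mono (hF.sub hgw).abs ((hqi.sub hwC).const_mul B) fun t' => ?_
        dsimp only
        have h1 : 0 ≤ imhAcceptQ w q t t' * q t' - w t' / C :=
          sub_nonneg.2 (imhAcceptQ_mul_ge hw0 hq0 hC t t')
        have h2 : 0 ≤ (1 - imhAcceptQ w q t t') * q t' :=
          mul_nonneg (sub_nonneg.2 (imhAcceptQ_le_one w q t t')) (hq0 t').le
        calc |(imhAcceptQ w q t t' * g t' + (1 - imhAcceptQ w q t t') * g t) * q t'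
              - g t' * (w t' / C)|
            = |(imhAcceptQ w q t t' * q t' - w t' / C) * g t'
                + (1 - imhAcceptQ w q t t') * q t' * g t| := by congr 1; ring
          _ ≤ |(imhAcceptQ w q t t' * q t' - w t' / C) * g t'|
                + |(1 - imhAcceptQ w q t t') * q t' * g t| := abs_add_le _ _
          _ = (imhAcceptQ w q t t' * q t' - w t' / C) * |g t'|
                + (1 - imhAcceptQ w q t t') * q t' * |g t| := by
              rw [abs_mul, abs_mul, abs_of_nonneg h1, abs_of_nonneg h2]
          _ ≤ (imhAcceptQ w q t t' * q t' - w t' / C) * B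
                + (1 - imhAcceptQ w q t t') * q t' * B :=
              add_le_add (mul_le_mul_of_nonneg_left (hgb t') h1)
                (mul_le_mul_of_nonneg_left (hgb t) h2)
          _ = B * (q t' - w t' / C) := by ring
    _ = (1 - (∫ s, w s ∂μ) / C) * B := by
        rw [integral_const_mul, integral_sub hqi hwC, hq1, integral_div, mul_comm]

variable [SFinite μ]

/-- **Geometric sup-norm decay of the iterates**: `w ≤ C·q`, `g` centred bounded measurable ⇒
`|Kⁿ g(t)| ≤ (1 − Z/C)ⁿ·B` (induction; `K` preserves measurability, the bound and the centring,
`imhOp_iterate_invariants`). [folklore] -/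
theorem abs_imhOp_iterate_le_of_centred (hw0 : ∀ t, 0 < w t) (hwm : Measurable w)
    (hwi : Integrable w μ) (hq0 : ∀ t, 0 < q t) (hqm : Measurable q) (hqi : Integrable q μ)
    (hq1 : ∫ t, q t ∂μ = 1) {C : ℝ} (hC : ∀ t, w t ≤ C * q t) :
    ∀ (n : ℕ) {g : X → ℝ} {B : ℝ}, Measurable g → (∀ t, |g t| ≤ B) → ∫ t, g t * w t ∂μ = 0 →
      ∀ t, |((imhOp μ w q)^[n] g) t| ≤ (1 - (∫ s, w s ∂μ) / C) ^ n * B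
  | 0, g, B, _, hgb, _ => fun t => by simpa using hgb t
  | n + 1, g, B, hgm, hgb, hg0 => fun t => by
    rw [Function.iterate_succ_apply, pow_succ, mul_assoc]
    have hKb : ∀ s, |imhOp μ w q g s| ≤ (1 - (∫ s, w s ∂μ) / C) * B :=
      abs_imhOp_le_rate_mul_of_centred hw0 hwm hwi hq0 hqm hqi hq1 hC hgm hgb hg0
    have hK0 : ∫ s, imhOp μ w q g s * w s ∂μ = 0 := by
      rw [integral_imhOp_mul hw0 hwm hwi hq0 hqm hqi hq1 hgm hgb, hg0]
    exact abs_imhOp_iterate_le_of_centred hw0 hwm hwi hq0 hqm hqi hq1 hC n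
      (measurable_imhOp hwm hqm hgm) hKb hK0 t

/-- **The partial Neumann sums are uniformly bounded under a weight ceiling**:
`|Σ_{k≤N} Kᵏ g(t)| ≤ B·C/Z` for centred `g` (`Σ_k (1 − Z/C)ᵏ ≤ C/Z`). [folklore] -/
theorem abs_neumannSum_le_of_centred (hw0 : ∀ t, 0 < w t) (hwm : Measurable w)
    (hwi : Integrable w μ) (hq0 : ∀ t, 0 < q t) (hqm : Measurable q) (hqi : Integrable q μ)
    (hq1 : ∫ t, q t ∂μ = 1) {C : ℝ} (hC : ∀ t, w t ≤ C * q t) {g : X → ℝ} (hgm : Measurable g)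
    {B : ℝ} (hgb : ∀ t, |g t| ≤ B) (hg0 : ∫ t, g t * w t ∂μ = 0) (N : ℕ) (t : X) :
    |∑ k ∈ Finset.range (N + 1), ((imhOp μ w q)^[k] g) t| ≤ B * (C / ∫ s, w s ∂μ) := by
  obtain ⟨hZ, hCpos, hr0, hr1⟩ := rate_bounds hw0 hwi hq0 hqi hq1 hC
  have hB : 0 ≤ B := (abs_nonneg _).trans (hgb t)
  set r := 1 - (∫ s, w s ∂μ) / C with hr
  have hgeom : ∑ k ∈ Finset.range (N + 1), r ^ k ≤ C / ∫ s, w s ∂μ := by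
    have h := geom_sum_Ico_le_of_lt_one hr0 hr1 (m := 0) (n := N + 1)
    rw [← Finset.range_eq_Ico, pow_zero] at h
    refine h.trans (le_of_eq ?_)
    rw [hr, sub_sub_cancel, one_div, inv_div]
  calc |∑ k ∈ Finset.range (N + 1), ((imhOp μ w q)^[k] g) t|
      ≤ ∑ k ∈ Finset.range (N + 1), |((imhOp μ w q)^[k] g) t| := Finset.abs_sum_le_sum_abs _ _
    _ ≤ ∑ k ∈ Finset.range (N + 1), r ^ k * B := Finset.sum_le_sum fun k _ =>
        abs_imhOp_iterate_le_of_centred hw0 hwm hwi hq0 hqm hqi hq1 hC k hgm hgb hg0 t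
    _ = B * ∑ k ∈ Finset.range (N + 1), r ^ k := by rw [Finset.mul_sum]; exact Finset.sum_congr rfl fun k _ => mul_comm _ _
    _ ≤ B * (C / ∫ s, w s ∂μ) := mul_le_mul_of_nonneg_left hgeom hB

/-! ## §2 The window law with an arbitrary Neumann-sum bound -/

/-- **THE WINDOW LAW OF `IMHTauIntParityDefect` WITH AN ARBITRARY NEUMANN BOUND.**  Parity
`|log q − log q'| ≤ δ` off a measurable `E`; `g` bounded measurable with summable autocovariances
under `K = imhOp μ w q`; `V` a uniform bound on the partial Neumann sums of `K' = imhOp μ w q'`.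
Then for every `N`:
`Σ_{k≤N} ∫ g (K'ᵏ g) w ≤ e^{δ}·(∫ g² w + Σ_{k≥0} ∫ g (K^{k+1} g) w) + e^{−δ}·4V²·min(∫_E w, Z∫_E q)`. -/
theorem partialSum_autocov_le_of_logParityOff_of_neumannBound {q' : X → ℝ} (hw0 : ∀ t, 0 < w t)
    (hwm : Measurable w) (hwi : Integrable w μ) (hq0 : ∀ t, 0 < q t) (hqm : Measurable q)
    (hqi : Integrable q μ) (hq1 : ∫ z, q z ∂μ = 1) (hq0' : ∀ t, 0 < q' t) (hqm' : Measurable q')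
    (hqi' : Integrable q' μ) (hq1' : ∫ z, q' z ∂μ = 1) {E : Set X} (hE : MeasurableSet E)
    {δ : ℝ} (hlog : ∀ t, t ∉ E → |Real.log (q t) - Real.log (q' t)| ≤ δ) {g : X → ℝ}
    (hgm : Measurable g) {B : ℝ} (hgb : ∀ t, |g t| ≤ B)
    (hs : Summable fun k => ∫ t, g t * ((imhOp μ w q)^[k + 1] g) t * w t ∂μ) (N : ℕ) {V : ℝ}
    (hV : ∀ x, |∑ k ∈ Finset.range (N + 1), ((imhOp μ w q')^[k] g) x| ≤ V) :
    ∑ k ∈ Finset.range (N + 1), ∫ t, g t * ((imhOp μ w q')^[k] g) t * w t ∂μ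
      ≤ Real.exp δ * ((∫ t, g t ^ 2 * w t ∂μ) + ∑' k, ∫ t, g t * ((imhOp μ w q)^[k + 1] g) t * w t ∂μ)
        + Real.exp (-δ) * (4 * V ^ 2 * min (∫ t in E, w t ∂μ) ((∫ t, w t ∂μ) * ∫ t in E, q t ∂μ)) := by
  obtain ⟨hm, -, -⟩ := neumannSum_facts hw0 hwm hq0' hqm' hqi' hq1' hgm hgb N
  have hdir' := dirichlet_neumannSum_le hw0 hwm hwi hq0' hqm' hqi' hq1' hgm hgb N
  set c : ℝ := Real.exp (-δ) with hcdef
  have hc : 0 < c := Real.exp_pos _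
  have hterm : ∀ k, Integrable (fun t => g t * ((imhOp μ w q')^[k] g) t * w t) μ := fun k => by
    obtain ⟨hkm, hkb⟩ := imhOp_iterate_bdd (μ := μ) hw0 hwm hq0' hqm' hqi' hq1' k hgm hgb
    exact integrable_mul_mul_weight hw0 hwm hwi hgm hkm hgb hkb
  have hinner : ∫ t, g t * (∑ k ∈ Finset.range (N + 1), ((imhOp μ w q')^[k] g) t) * w t ∂μ
      = ∑ k ∈ Finset.range (N + 1), ∫ t, g t * ((imhOp μ w q')^[k] g) t * w t ∂μ := by
    rw [← integral_finsetSum _ fun k _ => hterm k]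
    refine integral_congr_ae (Eventually.of_forall fun t => ?_)
    show g t * (∑ k ∈ Finset.range (N + 1), ((imhOp μ w q')^[k] g) t) * w t
      = ∑ k ∈ Finset.range (N + 1), g t * ((imhOp μ w q')^[k] g) t * w t
    rw [Finset.mul_sum, Finset.sum_mul]
  have hcmp := dirichlet_ge_exp_neg_mul_sub_parityDefect hw0 hwm hwi hq0 hqm hqi hq1 hq0' hqm' hqi'
    hq1' hE hlog hm hV
  have hD1 := parityDefect_le_targetMass hw0 hwm hwi hq0 hqm hqi hq1 hE hm hV
  have hD2 := parityDefect_le_modelMass hw0 hwm hwi hq0 hqm hqi hE hm hV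
  have hcm : Measurable fun x => c * ∑ k ∈ Finset.range (N + 1), ((imhOp μ w q')^[k] g) x :=
    hm.const_mul c
  have hcb : ∀ x, |c * ∑ k ∈ Finset.range (N + 1), ((imhOp μ w q')^[k] g) x| ≤ c * V :=
    fun x => by rw [abs_mul, abs_of_pos hc]; exact mul_le_mul_of_nonneg_left (hV x) hc.le
  have hvar := two_inner_sub_dirichlet_le_greenKubo hw0 hwm hwi hq0 hqm hqi hq1 hgm hgb hs hcm hcb
  rw [dirichlet_const_mul] at hvar
  have hlin : ∫ t, g t * (c * ∑ k ∈ Finset.range (N + 1), ((imhOp μ w q')^[k] g) t) * w t ∂μ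
      = c * ∫ t, g t * (∑ k ∈ Finset.range (N + 1), ((imhOp μ w q')^[k] g) t) * w t ∂μ := by
    rw [← integral_const_mul]
    exact integral_congr_ae (Eventually.of_forall fun t => by ring)
  rw [hlin, hinner] at hvar
  set P : ℝ := ∑ k ∈ Finset.range (N + 1), ∫ t, g t * ((imhOp μ w q')^[k] g) t * w t ∂μ with hP
  set S : ℝ := (∫ t, g t ^ 2 * w t ∂μ) + ∑' k, ∫ t, g t * ((imhOp μ w q)^[k + 1] g) t * w t ∂μ
    with hS
  set D : ℝ := (1 / 2) * ∫ p, ((E ×ˢ (univ : Set X)) ∪ ((univ : Set X) ×ˢ E)).indicator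
      (fun p : X × X => imhFlow w q p.1 p.2 *
        ((∑ k ∈ Finset.range (N + 1), ((imhOp μ w q')^[k] g) p.1)
          - ∑ k ∈ Finset.range (N + 1), ((imhOp μ w q')^[k] g) p.2) ^ 2) p ∂(μ.prod μ) with hD
  set M : ℝ := min (∫ t in E, w t ∂μ) ((∫ t, w t ∂μ) * ∫ t in E, q t ∂μ) with hM
  have hDM : D ≤ 4 * V ^ 2 * M := by
    rcases le_total (∫ t in E, w t ∂μ) ((∫ t, w t ∂μ) * ∫ t in E, q t ∂μ) with h | h
    · rw [hM, min_eq_left h]; exact hD1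
    · rw [hM, min_eq_right h]; linarith [hD2]
  have hexp : Real.exp δ = c⁻¹ := by rw [hcdef, Real.exp_neg, inv_inv]
  rw [hexp]
  have key : c * P ≤ S + c ^ 2 * D := by
    nlinarith [mul_le_mul_of_nonneg_left hdir' hc.le, mul_le_mul_of_nonneg_left hcmp hc.le, hvar]
  have key3 : c * P ≤ S + c ^ 2 * (4 * V ^ 2 * M) := by
    have h := mul_le_mul_of_nonneg_left hDM (sq_nonneg c)
    linarith
  calc P = c⁻¹ * (c * P) := by rw [← mul_assoc, inv_mul_cancel₀ hc.ne', one_mul]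
    _ ≤ c⁻¹ * (S + c ^ 2 * (4 * V ^ 2 * M)) := mul_le_mul_of_nonneg_left key3 (inv_pos.2 hc).le
    _ = c⁻¹ * S + c * (4 * V ^ 2 * M) := by
        rw [mul_add, pow_two, mul_assoc c c, ← mul_assoc c⁻¹ c, inv_mul_cancel₀ hc.ne', one_mul]

/-! ## §3 Window-free: the full Green–Kubo sum and `τ_int` under a weight ceiling -/

/-- **THE FULL GREEN–KUBO SUM OF THE OTHER MODEL UNDER A PARITY OFF `E` AND A WEIGHT CEILING.**
`w ≤ C'·q'`; `g` centred (`∫ g w = 0`), bounded measurable, summable autocovariances under `K`.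
Then the autocovariances under `K'` are summable and
`∫ g² w + Σ_{k≥0} ∫ g (K'^{k+1} g) w ≤ e^{δ}·S + e^{−δ}·4(B C'/Z)²·min(∫_E w, Z∫_E q)`. -/
theorem greenKubo_le_of_logParityOff_of_weightBound {q' : X → ℝ} (hw0 : ∀ t, 0 < w t)
    (hwm : Measurable w) (hwi : Integrable w μ) (hq0 : ∀ t, 0 < q t) (hqm : Measurable q)
    (hqi : Integrable q μ) (hq1 : ∫ z, q z ∂μ = 1) (hq0' : ∀ t, 0 < q' t) (hqm' : Measurable q')
    (hqi' : Integrable q' μ) (hq1' : ∫ z, q' z ∂μ = 1) {C' : ℝ} (hC' : ∀ t, w t ≤ C' * q' t)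
    {E : Set X} (hE : MeasurableSet E) {δ : ℝ}
    (hlog : ∀ t, t ∉ E → |Real.log (q t) - Real.log (q' t)| ≤ δ) {g : X → ℝ} (hgm : Measurable g)
    {B : ℝ} (hgb : ∀ t, |g t| ≤ B) (hg0 : ∫ t, g t * w t ∂μ = 0)
    (hs : Summable fun k => ∫ t, g t * ((imhOp μ w q)^[k + 1] g) t * w t ∂μ) :
    Summable (fun k => ∫ t, g t * ((imhOp μ w q')^[k + 1] g) t * w t ∂μ) ∧
      (∫ t, g t ^ 2 * w t ∂μ) + ∑' k, ∫ t, g t * ((imhOp μ w q')^[k + 1] g) t * w t ∂μ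
        ≤ Real.exp δ * ((∫ t, g t ^ 2 * w t ∂μ)
              + ∑' k, ∫ t, g t * ((imhOp μ w q)^[k + 1] g) t * w t ∂μ)
          + Real.exp (-δ) * (4 * (B * (C' / ∫ s, w s ∂μ)) ^ 2
              * min (∫ t in E, w t ∂μ) ((∫ t, w t ∂μ) * ∫ t in E, q t ∂μ)) := by
  obtain ⟨hZ, hCpos, hr0, hr1⟩ := rate_bounds hw0 hwi hq0' hqi' hq1' hC'
  -- summability under `K'` from the geometric decay of the weight-bounded sampler
  have hrabs : |1 - (∫ s, w s ∂μ) / C'| < 1 := by rw [abs_of_nonneg hr0]; exact hr1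
  have hbound : ∀ k, ‖∫ t, g t * ((imhOp μ w q')^[k + 1] g) t * w t ∂μ‖
      ≤ (∫ t, g t ^ 2 * w t ∂μ) * (1 - (∫ s, w s ∂μ) / C') ^ (k + 1) := fun k => by
    rw [Real.norm_eq_abs, mul_comm]
    exact abs_autocov_le hw0 hwm hwi hq0' hqm' hqi' hq1' hC' hgm hgb hg0 (k + 1)
  have hs' : Summable fun k => ∫ t, g t * ((imhOp μ w q')^[k + 1] g) t * w t ∂μ :=
    Summable.of_norm_bounded
      (((hasSum_geometric_succ hrabs).summable).mul_left (∫ t, g t ^ 2 * w t ∂μ)) hbound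
  refine ⟨hs', ?_⟩
  -- the `k = 0` term is `∫ g² w`, so `∫ g² w + Σ_{k<N} C'(k+1) = Σ_{k≤N} C'(k) ≤ bound` for all `N`
  have hC0 : ∫ t, g t * ((imhOp μ w q')^[0] g) t * w t ∂μ = ∫ t, g t ^ 2 * w t ∂μ := by
    simp only [Function.iterate_zero, id_eq]
    exact integral_congr_ae (Eventually.of_forall fun t => by ring)
  have hwin : ∀ N, ∑ k ∈ Finset.range N, ∫ t, g t * ((imhOp μ w q')^[k + 1] g) t * w t ∂μ
      ≤ Real.exp δ * ((∫ t, g t ^ 2 * w t ∂μ)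
            + ∑' k, ∫ t, g t * ((imhOp μ w q)^[k + 1] g) t * w t ∂μ)
        + Real.exp (-δ) * (4 * (B * (C' / ∫ s, w s ∂μ)) ^ 2
            * min (∫ t in E, w t ∂μ) ((∫ t, w t ∂μ) * ∫ t in E, q t ∂μ))
        - ∫ t, g t ^ 2 * w t ∂μ := fun N => by
    have h := partialSum_autocov_le_of_logParityOff_of_neumannBound hw0 hwm hwi hq0 hqm hqi hq1
      hq0' hqm' hqi' hq1' hE hlog hgm hgb hs N
      (abs_neumannSum_le_of_centred hw0 hwm hwi hq0' hqm' hqi' hq1' hC' hgm hgb hg0 N)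
    rw [Finset.sum_range_succ', hC0] at h
    linarith
  have h := hs'.tsum_le_of_sum_range_le hwin
  linarith

/-- **`τ_int` OF THE OTHER MODEL UNDER A PARITY OFF `E` AND A WEIGHT CEILING — WINDOW-FREE.**
In the setting of `greenKubo_le_of_logParityOff_of_weightBound` with `∫ g² w > 0`, on
`Scoring.tauInt` (`ρ = C/∫ g² w`):
`τ' + ½ ≤ e^{δ}(τ + ½) + e^{−δ}·4(B C'/Z)²·min(∫_E w, Z∫_E q)/∫ g² w`. -/
theorem imhOp_tauInt_le_of_logParityOff_of_weightBound {q' : X → ℝ} (hw0 : ∀ t, 0 < w t)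
    (hwm : Measurable w) (hwi : Integrable w μ) (hq0 : ∀ t, 0 < q t) (hqm : Measurable q)
    (hqi : Integrable q μ) (hq1 : ∫ z, q z ∂μ = 1) (hq0' : ∀ t, 0 < q' t) (hqm' : Measurable q')
    (hqi' : Integrable q' μ) (hq1' : ∫ z, q' z ∂μ = 1) {C' : ℝ} (hC' : ∀ t, w t ≤ C' * q' t)
    {E : Set X} (hE : MeasurableSet E) {δ : ℝ}
    (hlog : ∀ t, t ∉ E → |Real.log (q t) - Real.log (q' t)| ≤ δ) {g : X → ℝ} (hgm : Measurable g)
    {B : ℝ} (hgb : ∀ t, |g t| ≤ B) (hg0 : ∫ t, g t * w t ∂μ = 0)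
    (hs : Summable fun k => ∫ t, g t * ((imhOp μ w q)^[k + 1] g) t * w t ∂μ)
    (hA : 0 < ∫ t, g t ^ 2 * w t ∂μ) :
    tauInt (fun k => (∫ t, g t * ((imhOp μ w q')^[k] g) t * w t ∂μ) / ∫ t, g t ^ 2 * w t ∂μ)
        + 1 / 2
      ≤ Real.exp δ * (tauInt (fun k => (∫ t, g t * ((imhOp μ w q)^[k] g) t * w t ∂μ)
            / ∫ t, g t ^ 2 * w t ∂μ) + 1 / 2)
        + Real.exp (-δ) * (4 * (B * (C' / ∫ s, w s ∂μ)) ^ 2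
            * min (∫ t in E, w t ∂μ) ((∫ t, w t ∂μ) * ∫ t in E, q t ∂μ)) / ∫ t, g t ^ 2 * w t ∂μ := by
  obtain ⟨-, hle⟩ := greenKubo_le_of_logParityOff_of_weightBound hw0 hwm hwi hq0 hqm hqi hq1 hq0'
    hqm' hqi' hq1' hC' hE hlog hgm hgb hg0 hs
  set A : ℝ := ∫ t, g t ^ 2 * w t ∂μ with hAdef
  set T : ℝ := ∑' k, ∫ t, g t * ((imhOp μ w q)^[k + 1] g) t * w t ∂μ with hTdef
  set T' : ℝ := ∑' k, ∫ t, g t * ((imhOp μ w q')^[k + 1] g) t * w t ∂μ with hT'def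
  set R : ℝ := Real.exp (-δ) * (4 * (B * (C' / ∫ s, w s ∂μ)) ^ 2
      * min (∫ t in E, w t ∂μ) ((∫ t, w t ∂μ) * ∫ t in E, q t ∂μ)) with hRdef
  simp only [tauInt]
  rw [tsum_div_const, tsum_div_const]
  have hAne := hA.ne'
  have e1 : 1 / 2 + T' / A + 1 / 2 = (A + T') / A := by
    field_simp; ring
  have e2 : Real.exp δ * (1 / 2 + T / A + 1 / 2) + R / A = (Real.exp δ * (A + T) + R) / A := by
    field_simp; ring
  rw [e1, e2]
  exact div_le_div_of_nonneg_right hle hA.le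

end Summit.Ventures.LatticeQCDFlow.Exactness
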